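import Literature.IUT.HodgeArakelov.MonoThetaCyclotomes
import Literature.IUT.HodgeArakelov.AbsTopMonoidsNonVacuity
import Literature.AnabelianGeometry.AbsoluteAnabelian.MLFGaloisElasticProofs
import HarnessLib

/-!
# (H1) «`Δ ⊆ Π` is characteristic» for [IUTchII] §1 settings modelled on PROFINITE extensions with MLF base

S. Mochizuki, *Inter-universal Teichmüller theory II*, §1, Example 1.8 (i) (kurims p. 35, l. 42–48), in the
definition of the radial data `(Π, G, α)`: "the full poly-isomorphism [cf. [IUTchI], §0] of topological groups
α : Π/Δ ⥲ G, where we write Δ ⊆ Π for the [group-theoretic! — cf., e.g., [AbsAnab], Lemma 1.3.8] subgroup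
corresponding to Δ^tp_{X̲̲_k}" [claim: Mochizuki2012, status: disputed] (the square bracket is print's own).
Print's pointer for the group-theoreticity of `Δ ⊆ Π` is [AbsAnab] Lemma 1.3.8 (kurims p. 18); for the
PROFINITE models treated in this file the cell uses [AbsTopI] Thm 2.6 (iv) (kurims p. 22, l. 4–7): "If,
moreover, Σ ≠ Primes, then the kernel of the quotient Π ↠ G may be characterized [“group-theoretically”]
as the maximal almost pro-omissive topologically finitely generated closed normal subgroup of Π" (print's
own brackets and quotation marks).  (Doc-only v2, abc-iut-w5-d206 gen 6: the v1 header and the docstring of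
`deltaX_map_eq_of_fundamentalExtension` carried a PARAPHRASE of these two sentences inside quotation marks —
referee letters P23-F1 / O12-F25; the quotations above are now print's words; no declaration changed.)
In the abc-iut cell this group-theoreticity is the hypothesis
(H1) `∀ f : Π ≃ₜ* Π, Δ.map f = Δ` of EVERY producer of the [IUTchII] Ex 1.8 output interface
`AbsTopMonoids S` (`AbsTopMonoids.nonempty_iff`, `AbsTopMonoids.degenerate`, `AbsTopMonoids.genuineOfModel`;
L6-t13 HANDOFF / L6-lead §F v1.19j (3): «(H1) stays a hypothesis of every AbsTopMonoids producer» — an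
L4-side residual).

THIS PROOF-ONLY FILE (no definitions, no named facts) DISCHARGES (H1) for every setting `S : ThetaSetting.{0}`
whose augmented group `Π ↠ G_k` is identified with a PROFINITE extension `1 → Δ → Π → G → 1`
(`FundamentalExtension`) with MLF base data `G ≅ G_K`, `Δ` topologically finitely generated
([AbsTopI] Prop 2.2, BY NAME: `E.GeomTFG`) and pro-`Σ` for some `Σ ⊊ Primes` — by the cell's kernel
theorem [AbsTopI] Thm 2.6 (iv) (`FundamentalExtension.MLFBase.preservesGeom`, whose elasticity input
[AbsTopI] Thm 1.7 (ii) is the theorem `isElastic_absoluteGaloisGroup`, GAP row G-w5d206-1):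

* `ThetaSetting.deltaX_map_eq_of_fundamentalExtension` — (H1) for such `S`;
* `ThetaSetting.deltaX_characteristic_of_fundamentalExtension` — packaged with the transport;
* (appended) `ThetaSetting.nonempty_quotDeltaX_iso_of_compactSpace` — (H2) for compact `Π`, Hausdorff `G_k`;
  `ThetaSetting.deltaX_map_eq_geom_of_compatible`; and
  `ThetaSetting.nonempty_absTopMonoids_of_fundamentalExtension` — **`AbsTopMonoids S` INHABITED** at every
  profinite MLF-based model (both hypotheses of `AbsTopMonoids.nonempty_iff` discharged there).

HONEST SCOPE: print's `Π^tp_{X̲̲_k}` is the TEMPERED fundamental group (not compact); the interface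
`ThetaSetting.PiX` is a bare topological group, and this file covers the PROFINITE models of it (the
profinite `Π_{X̲̲_k}` satisfies «`Δ` characteristic» by Thm 2.6 (iv); the tempered statement is
[SemiAnbd] Thm 6.6-level and is NOT addressed).  (H2) «`Π/Δ ≅ G_k`» is not touched.  Nothing here bears on
[IUTchIII] Cor. 3.12; no side is taken.
-/

noncomputable section

namespace Literature.IUT.HodgeArakelov

open Literature.AnabelianGeometry.AbsoluteAnabelian

namespace ThetaSetting

/-- **(H1) for profinite MLF-based models.**  Let `S : ThetaSetting` and suppose `Π^{(S)} = S.PiX` is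
identified, by an isomorphism of topological groups `e`, with the arithmetic group `Π` of an extension
`E : FundamentalExtension` carrying MLF base data `B : E.MLFBase`, with `e(Δ^{(S)}) = Δ_E`, `Δ_E`
topologically finitely generated ([AbsTopI] Prop 2.2 by name) and pro-`Σ` for some `Σ ⊊ Primes`.  Then
`Δ^{(S)}` is carried onto itself by EVERY automorphism of topological groups of `Π^{(S)}` — [AbsTopI]
Thm 2.6 (iv) (kurims p. 22, l. 4–7: "the kernel of the quotient Π ↠ G may be characterized
[“group-theoretically”] as the maximal almost pro-omissive topologically finitely generated closed normal
subgroup of Π"), via `MLFBase.preservesGeom`.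
[cite: MochizukiAbsTopI2012, Thm 2.6 (iv) p.22] -/
theorem deltaX_map_eq_of_fundamentalExtension (S : ThetaSetting.{0}) (E : FundamentalExtension.{0})
    (B : E.MLFBase) (hΔ : E.GeomTFG) {Sigma : Set ℕ} (hSigsub : Sigma ⊆ {q | q.Prime})
    (hSigne : Sigma ≠ {q | q.Prime}) (hpro : IsProSet E.geom Sigma) (e : S.PiX ≃ₜ* E.arith)
    (he : S.DeltaX.map e.toMulEquiv.toMonoidHom = E.geom) (f : S.PiX ≃ₜ* S.PiX) :
    S.DeltaX.map f.toMulEquiv.toMonoidHom = S.DeltaX := by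
  -- conjugate `f` into an automorphism `φ := e ∘ f ∘ e⁻¹` of `Π_E`
  let φ : E.arith ≃ₜ* E.arith := (e.symm.trans f).trans e
  have hφ : FundamentalExtension.PreservesGeom φ :=
    FundamentalExtension.MLFBase.preservesGeom B B hΔ hΔ hSigsub hSigne hpro hSigsub hSigne hpro φ
  -- `Δ^{(S)} = e⁻¹(Δ_E)`
  have hback : S.DeltaX = E.geom.map e.symm.toMulEquiv.toMonoidHom := by
    rw [← he, Subgroup.map_map]
    have : e.symm.toMulEquiv.toMonoidHom.comp e.toMulEquiv.toMonoidHom = MonoidHom.id _ := by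
      ext x; exact e.symm_apply_apply x
    rw [this, Subgroup.map_id]
  -- `f(Δ^{(S)}) = e⁻¹(φ(Δ_E)) = e⁻¹(Δ_E) = Δ^{(S)}`
  have hcomp : f.toMulEquiv.toMonoidHom.comp e.symm.toMulEquiv.toMonoidHom =
      e.symm.toMulEquiv.toMonoidHom.comp φ.toMulEquiv.toMonoidHom := by
    ext x
    change f (e.symm x) = e.symm (e (f (e.symm x)))
    rw [e.symm_apply_apply]
  rw [hback, Subgroup.map_map, hcomp, ← Subgroup.map_map]
  change (E.geom.map φ.toMulEquiv.toMonoidHom).map _ = _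
  rw [hφ]

/-- **(H1) is invariant under identification**: for `S` modelled on `E` as above, (H1) holds for `S.PiX`;
stated as the `∀ f` form consumed by `AbsTopMonoids.nonempty_iff` / `AbsTopMonoids.degenerate` /
`AbsTopMonoids.genuineOfModel`. [cite: MochizukiAbsTopI2012, Thm 2.6 (iv) p.22] -/
theorem deltaX_characteristic_of_fundamentalExtension (S : ThetaSetting.{0})
    (h : ∃ (E : FundamentalExtension.{0}) (_ : E.MLFBase) (Sigma : Set ℕ) (e : S.PiX ≃ₜ* E.arith),
      E.GeomTFG ∧ Sigma ⊆ {q | q.Prime} ∧ Sigma ≠ {q | q.Prime} ∧ IsProSet E.geom Sigma ∧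
        S.DeltaX.map e.toMulEquiv.toMonoidHom = E.geom) :
    ∀ f : S.PiX ≃ₜ* S.PiX, S.DeltaX.map f.toMulEquiv.toMonoidHom = S.DeltaX := by
  obtain ⟨E, B, Sigma, e, hΔ, hSigsub, hSigne, hpro, he⟩ := h
  exact deltaX_map_eq_of_fundamentalExtension S E B hΔ hSigsub hSigne hpro e he

/-! ### (H2) «`Π/Δ ≅ G_k`» for compact `Π`, and the interface `AbsTopMonoids S` INHABITED at profinite
MLF-based models (appended by abc-iut-w5-d206, same session) -/

/-- **(H2) for settings with compact `Π` and Hausdorff `G_k`**: the augmentation `Π ↠ G_k` (continuous,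
surjective, kernel `Δ`) induces an isomorphism of topological groups `Π/Δ ⥲ G_k` — a continuous bijection
from a compact space onto a Hausdorff space is a homeomorphism.  (Print's `Π^tp` is tempered, not compact:
this covers the PROFINITE models of the interface.) [cite: MochizukiAbsTopI2012, Def 2.1 p.18] -/
theorem nonempty_quotDeltaX_iso_of_compactSpace (S : ThetaSetting.{0}) [CompactSpace S.PiX]
    [T2Space S.Gk] : Nonempty (TopGroup.quot S.PiX S.DeltaX ≃ₜ* S.Gk) := by
  let φ : S.PiX ⧸ S.DeltaX ≃* S.Gk := QuotientGroup.quotientKerEquivOfSurjective S.aug S.aug_surjective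
  have hφmk : (φ : S.PiX ⧸ S.DeltaX → S.Gk) ∘ QuotientGroup.mk = S.aug := by
    funext x; exact QuotientGroup.kerLift_mk S.aug x
  have hφc : Continuous φ := by
    refine (QuotientGroup.isQuotientMap_mk S.DeltaX).continuous_iff.mpr ?_
    rw [hφmk]
    exact S.aug_continuous
  let h : S.PiX ⧸ S.DeltaX ≃ₜ S.Gk := hφc.homeoOfEquivCompactToT2 (f := φ.toEquiv)
  exact ⟨{ φ with continuous_toFun := hφc, continuous_invFun := h.symm.continuous }⟩

/-- **Compatibility of augmentations identifies the kernels**: if `e : Π^{(S)} ⥲ Π_E` and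
`e_G : G_k^{(S)} ⥲ G_E` intertwine the augmentations, then `e(Δ^{(S)}) = Δ_E`.
[cite: MochizukiAbsTopI2012, Def 2.1 p.18] -/
theorem deltaX_map_eq_geom_of_compatible (S : ThetaSetting.{0}) (E : FundamentalExtension.{0})
    (e : S.PiX ≃ₜ* E.arith) (eG : S.Gk ≃ₜ* E.gal) (hcompat : ∀ x, E.aug (e x) = eG (S.aug x)) :
    S.DeltaX.map e.toMulEquiv.toMonoidHom = E.geom := by
  ext y
  constructor
  · rintro ⟨x, hx, rfl⟩
    rw [FundamentalExtension.mem_geom]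
    change E.aug (e x) = 1
    rw [hcompat, show S.aug x = 1 from hx, map_one]
  · intro hy
    refine ⟨e.symm y, ?_, e.apply_symm_apply y⟩
    change S.aug (e.symm y) = 1
    apply eG.injective
    rw [map_one, ← hcompat, e.apply_symm_apply]
    exact (FundamentalExtension.mem_geom E).mp hy

/-- **The [IUTchII] Ex 1.8 output interface `AbsTopMonoids S` is INHABITED at every profinite MLF-based
model**: if the augmented group `Π^{(S)} ↠ G_k^{(S)}` of the setting `S` is identified (compatibly) with an
extension `E : FundamentalExtension` carrying MLF base data, with `Δ_E` topologically finitely generated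
and pro-`Σ` for some `Σ ⊊ Primes`, then (H1) (by [AbsTopI] Thm 2.6 (iv)) and (H2) (compactness) hold, so
`AbsTopMonoids S` is nonempty (`AbsTopMonoids.nonempty_iff`, degenerate witness).  HONEST LABEL: the
inhabitant is abc-iut-w5-d114's DEGENERATE `AbsTopMonoids.degenerate` (trivial monoids); what is new is that
its two hypotheses are DISCHARGED at this model class. [cite: MochizukiAbsTopI2012, Thm 2.6 (iv) p.22] -/
theorem nonempty_absTopMonoids_of_fundamentalExtension (S : ThetaSetting.{0})
    (E : FundamentalExtension.{0}) (B : E.MLFBase) (hΔ : E.GeomTFG) {Sigma : Set ℕ}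
    (hSigsub : Sigma ⊆ {q | q.Prime}) (hSigne : Sigma ≠ {q | q.Prime}) (hpro : IsProSet E.geom Sigma)
    (e : S.PiX ≃ₜ* E.arith) (eG : S.Gk ≃ₜ* E.gal) (hcompat : ∀ x, E.aug (e x) = eG (S.aug x)) :
    Nonempty (AbsTopMonoids S) := by
  haveI : CompactSpace S.PiX := e.toHomeomorph.symm.compactSpace
  haveI : T2Space S.Gk := eG.toHomeomorph.symm.t2Space
  exact AbsTopMonoids.nonempty_iff.mpr
    ⟨deltaX_map_eq_of_fundamentalExtension S E B hΔ hSigsub hSigne hpro e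
      (deltaX_map_eq_geom_of_compatible S E e eG hcompat),
     nonempty_quotDeltaX_iso_of_compactSpace S⟩

end ThetaSetting

end Literature.IUT.HodgeArakelov

end
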